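import Literature.NumberTheory.GaloisRepresentations.ResidualPair
import HarnessLib

/-!
# `HasResidualPair` / `HasResidualSemisimplification`: invariance under change of frame

Topic `Literature/NumberTheory/GaloisRepresentations`; proof-only sibling of `ResidualPair.lean`
(`FramedGaloisRep.HasResidualPair`, `FramedGaloisRep.HasResidualSemisimplification`).  Written for
definition item `defn-HasResidualPairVia` of route `Langlands/PhantomRMYoshida`, whose items
(PhantomRMSector, ResiduallyYoshidaLifting, StableYoshidaCongruence, RegularWeightRehearsal) inline
VERBATIM the clause that `ResidualPair.lean` already names `FramedGaloisRep.HasResidualPair`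
(`hasResidualPair_iff : … ↔ <clause>` is `Iff.rfl`; symmetry in `(σ, σ')` is
`HasResidualPair.symm`), so no new notion is introduced — this file only adds the requested API:

* (private) `hasFrobCharpolyAt_conj_iff_aux` — the Frobenius characteristic polynomial predicate
  of a framed Galois representation is invariant under `ρ ↦ g ρ g⁻¹` (Mathlib
  `Matrix.charpoly_units_conj`); a local copy of `FramedGaloisRep.hasFrobCharpolyAt_conj_iff` of
  `Automorphic/ReciprocityGLnProofs.lean` (not imported: wrong direction of dependency; the
  companion `isUnramifiedAt_conj_iff` is in `GaloisRep.lean`);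
* `hasResidualPair_conj_iff`, `hasResidualPair_conj_left_iff`, `hasResidualPair_conj_right_iff` —
  `HasResidualPair red σ σ'` is unchanged by conjugating `ρ` in `GL_n(ℚ̄_p)` or `σ`, `σ'` in
  `GL(k)`; `hasResidualPair_comm`;
* `hasResidualSemisimplification_conj_iff`, `hasResidualSemisimplification_conj_right_iff`.

Everything here is PROVED (theorems only).  NOT here: the `p`-integrality of `charpoly ρ(Frob_v)`
for compact image (so that the `∃ P` clause only concerns the factorisation) — a theorem about
eigenvalues of compact subgroups of `GL_n(ℚ̄_p)`, left to a later file.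

## References
* J.-P. Serre, *Abelian ℓ-adic representations and elliptic curves* (1968), Ch. I §2.3
  (Frobenius characteristic polynomials determine the semisimplification). [SerreAbelianLadic1968]
* P. Deligne, J.-P. Serre, Formes modulaires de poids 1, Ann. Sci. ÉNS 7 (1974), §6. [DeligneSerre1974]
-/

noncomputable section

open IsDedekindDomain Filter
open scoped NumberField

namespace Literature.NumberTheory.GaloisRepresentations

namespace FramedGaloisRep

variable {K : Type} [Field K] {p : ℕ} [Fact p.Prime]
variable {k : Type*} [Field k] [TopologicalSpace k]
variable {n a b : ℕ}

/-- The Frobenius characteristic polynomial predicate is invariant under change of frame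
`r ↦ g r g⁻¹` (`charpoly (g M g⁻¹) = charpoly M`, Mathlib `Matrix.charpoly_units_conj`).
A `private` local copy of `FramedGaloisRep.hasFrobCharpolyAt_conj_iff`, which is declared (via
`_root_`) in the automorphic leaf file `Automorphic/ReciprocityGLnProofs.lean`; importing that file
here would make `GaloisRepresentations/` depend on `Automorphic/`.
Ref: Serre 1968, Ch. I §2.3 (characteristic polynomials of Frobenius are class functions). [folklore] -/
private theorem hasFrobCharpolyAt_conj_iff_aux {A : Type*} [CommRing A] [TopologicalSpace A]
    [IsTopologicalRing A] (v : HeightOneSpectrum (𝓞 K)) (Q : Polynomial A) (g : GL (Fin n) A)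
    (r : FramedGaloisRep K A n) :
    FramedGaloisRep.HasFrobCharpolyAt v Q (FramedRep.conj g r) ↔ r.HasFrobCharpolyAt v Q := by
  refine forall₂_congr fun 𝔓 _ => forall₂_congr fun s _ => ?_
  have h : FramedRep.charpoly (FramedRep.conj g r) s = FramedRep.charpoly r s := by
    unfold FramedRep.charpoly
    rw [FramedRep.conj_apply, Units.val_mul, Units.val_mul, Matrix.coe_units_inv,
      Matrix.charpoly_units_conj]
  rw [h]

variable {ρ : FramedGaloisRep K (PadicAlgCl p) n} {red : Valued.integer (PadicAlgCl p) →+* k}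
  {σ : FramedGaloisRep K k a} {σ' : FramedGaloisRep K k b} {τ : FramedGaloisRep K k n}

/-- **`HasResidualPair` is invariant under change of frame of `ρ`** (`ρ ↦ g ρ g⁻¹`,
`g ∈ GL_n(ℚ̄_p)`). [folklore] -/
theorem hasResidualPair_conj_iff (g : GL (Fin n) (PadicAlgCl p)) :
    FramedGaloisRep.HasResidualPair (FramedRep.conj g ρ) red σ σ' ↔ ρ.HasResidualPair red σ σ' := by
  simp only [HasResidualPair, isUnramifiedAt_conj_iff, hasFrobCharpolyAt_conj_iff_aux]

/-- **`HasResidualPair` is invariant under change of frame of `σ`** (`σ ↦ g σ g⁻¹`, `g ∈ GL_a(k)`).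
[folklore] -/
theorem hasResidualPair_conj_left_iff [IsTopologicalRing k] (g : GL (Fin a) k) :
    ρ.HasResidualPair red (FramedRep.conj g σ) σ' ↔ ρ.HasResidualPair red σ σ' := by
  simp only [HasResidualPair, isUnramifiedAt_conj_iff, hasFrobCharpolyAt_conj_iff_aux]

/-- **`HasResidualPair` is invariant under change of frame of `σ'`** (`σ' ↦ g σ' g⁻¹`, `g ∈ GL_b(k)`).
[folklore] -/
theorem hasResidualPair_conj_right_iff [IsTopologicalRing k] (g : GL (Fin b) k) :
    ρ.HasResidualPair red σ (FramedRep.conj g σ') ↔ ρ.HasResidualPair red σ σ' := by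
  simp only [HasResidualPair, isUnramifiedAt_conj_iff, hasFrobCharpolyAt_conj_iff_aux]

/-- `HasResidualPair` is symmetric in `(σ, σ')`, as an `iff`. [folklore] -/
theorem hasResidualPair_comm : ρ.HasResidualPair red σ σ' ↔ ρ.HasResidualPair red σ' σ :=
  ⟨HasResidualPair.symm, HasResidualPair.symm⟩

/-- **`HasResidualSemisimplification` is invariant under change of frame of `ρ`.** [folklore] -/
theorem hasResidualSemisimplification_conj_iff (g : GL (Fin n) (PadicAlgCl p)) :
    FramedGaloisRep.HasResidualSemisimplification (FramedRep.conj g ρ) red τ ↔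
      ρ.HasResidualSemisimplification red τ := by
  simp only [HasResidualSemisimplification, isUnramifiedAt_conj_iff, hasFrobCharpolyAt_conj_iff_aux]

/-- **`HasResidualSemisimplification` is invariant under change of frame of `τ`.** [folklore] -/
theorem hasResidualSemisimplification_conj_right_iff [IsTopologicalRing k] (g : GL (Fin n) k) :
    ρ.HasResidualSemisimplification red (FramedRep.conj g τ) ↔
      ρ.HasResidualSemisimplification red τ := by
  simp only [HasResidualSemisimplification, isUnramifiedAt_conj_iff, hasFrobCharpolyAt_conj_iff_aux]

end FramedGaloisRep

end Literature.NumberTheory.GaloisRepresentations
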